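import Mathlib.Analysis.Complex.Basic
import Literature.AnabelianGeometry.AbsoluteAnabelian.PanalocalTheaters
import HarnessLib

/-!
# [AbsTopIII] Def 5.6 (i): NON-VACUITY of the category `TB⊞` — the record `TBPlus` and its morphisms
# `TBPlus.Hom` (rows «NV-L4/TBPlus», «NV-L4/TBPlus.Hom»)

S. Mochizuki, *Topics in absolute anabelian geometry III*, J. Math. Sci. Univ. Tokyo 22 (2015); manuscript
Def 5.6 (i) p. 134: "a two-dimensional connected topological Lie group `B` equipped with two one-parameter
subgroups `B′, B″ ⊆ B` that determine an isomorphism `B′ × B″ ⥲ B` of topological groups, together with an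
isomorphism `β : Lie±(B′) ⥲ Lie±(B″)`"; Def 5.6 (iv) p. 136 names the intended example, the Lie algebra of
`ℂ^× ≅ 𝕊¹ × ℝ_{>0}`.  PROOF-ONLY companion (no `def`, no `instance`, no `structure`) of abc-iut-L4-t3's
`PanalocalTheaters.lean` (`TBPlus`, `TBPlus.Hom`); abc-iut-w5-d197's INHABITATION CENSUS L4 v1 §A lists both
with ZERO producers.  Recorded here, kernel-checked:

* `TBPlus.nonempty_model` / `exists_model_complex` — GENUINE model at universe 0: `B := ℂ` (the additive group
  `Lie(ℂ^×) = ℂ`, `exp : ℂ → ℂ^×`), `B′ := iℝ = Lie(𝕊¹)` parametrised by `c₁ s = s·i`, `B″ := ℝ = Lie(ℝ_{>0})`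
  parametrised by `c₂ t = t`, `β := 1`; the typed axioms (local injectivity, `B′ ∩ B″ = 0`, `B′ × B″ → B`
  surjective and open) are PROVED — openness through Mathlib's real-linear homeomorphism `ℂ ≃ ℝ × ℝ`
  (`Complex.equivRealProdCLM`);
* `TBPlus.nonempty_hom_refl` — GENERAL: every object of `TB⊞` has the identity endomorphism (`a₁ = a₂ = 1`);
  `TBPlus.exists_hom_neg` — a NON-identity endomorphism of every object: `x ↦ -x` (surjective, `a₁ = a₂ = -1`,
  `|a₂|·β = β·|a₁|`); `nonempty_hom_trans` — morphisms compose.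

HONEST FRAMING: witnesses are consistency evidence for OUR typed interface only ("connected, two-dimensional Lie
group" is modelled by the typed clauses, which the model satisfies); nothing of [AbsTopIII] is asserted; no
bearing on, and no side taken on, [IUTchIII] Cor 3.12.
-/

namespace Literature.AnabelianGeometry.AbsoluteAnabelian

namespace TBPlus

open _root_.Complex

/-- The map `(s, t) ↦ s·i + t : ℝ × ℝ → ℂ` is the real-linear homeomorphism `ℝ × ℝ ≃ ℂ` of Mathlib
(`equivRealProdCLM.symm`) precomposed with the coordinate swap. [folklore] -/
private theorem sum_eq_comp :
    (fun p : ℝ × ℝ => ((p.1 : ℂ) * I + (p.2 : ℂ))) =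
      (fun q : ℝ × ℝ => (equivRealProdCLM.symm q : ℂ)) ∘ (fun p : ℝ × ℝ => (p.2, p.1)) := by
  funext p
  apply Complex.ext <;> simp [equivRealProdCLM_symm_apply]

/-- **Def 5.6 (i)/(iv)** — NON-VACUITY (model, universe `0`): `(B, B′, B″, β) := (ℂ, iℝ, ℝ, 1)`, the Lie algebra
of `ℂ^× ≅ 𝕊¹ × ℝ_{>0}` with its two one-parameter subgroups; all typed axioms proved.
[cite: MochizukiAbsTopIII2015, Definition 5.6 (i) p.134] -/
theorem exists_model_complex :
    ∃ M : TBPlus.{0}, M.B = ℂ ∧ M.β = 1 := by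
  refine ⟨{ B := ℂ
            c₁ := ⟨⟨⟨fun s : ℝ => (s : ℂ) * I, by simp⟩, fun s t => by push_cast; ring⟩,
              by fun_prop⟩
            c₂ := ⟨⟨⟨fun t : ℝ => (t : ℂ), by simp⟩, fun s t => by push_cast; ring⟩,
              Complex.continuous_ofReal⟩
            exists_injOn := ⟨1, one_pos, ?_, ?_⟩
            add_injective := ?_
            add_surjective := ?_
            isOpenMap_add := ?_
            β := 1
            β_pos := one_pos }, rfl, rfl⟩
  · intro s _ t _ h
    have h' : (s : ℂ) * I = (t : ℂ) * I := h
    have := mul_right_cancel₀ I_ne_zero h'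
    exact_mod_cast this
  · intro s _ t _ h
    have h' : (s : ℂ) = (t : ℂ) := h
    exact_mod_cast h'
  · intro s t h
    have h' : (s : ℂ) * I = (t : ℂ) := h
    have hs : s = 0 := by
      have := congrArg Complex.im h'
      simpa using this
    show (s : ℂ) * I = 0
    simp [hs]
  · intro z
    refine ⟨(z.im, z.re), ?_⟩
    show ((z.im : ℂ) * I + (z.re : ℂ)) = z
    apply Complex.ext <;> simp
  · show IsOpenMap fun p : ℝ × ℝ => ((p.1 : ℂ) * I + (p.2 : ℂ))
    rw [sum_eq_comp]
    exact (equivRealProdCLM.symm.toHomeomorph.isOpenMap).comp (Homeomorph.prodComm ℝ ℝ).isOpenMap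

/-- **Def 5.6 (i)** — `TBPlus` is inhabited at universe `0` (by the model of `exists_model_complex`).
[cite: MochizukiAbsTopIII2015, Definition 5.6 (i) p.134] -/
theorem nonempty_model : Nonempty TBPlus.{0} :=
  let ⟨M, _, _⟩ := exists_model_complex; ⟨M⟩

universe u

/-- **Def 5.6 (i)** — GENERAL: every object `(B, B′, B″, β)` of `TB⊞` has the identity morphism (surjective,
carries `B′`, `B″` to themselves with parameter rescalings `a₁ = a₂ = 1`, compatible with `β`).
[cite: MochizukiAbsTopIII2015, Definition 5.6 (i) p.134] -/
theorem nonempty_hom_refl (M : TBPlus.{u}) : Nonempty (M.Hom M) :=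
  ⟨{ toHom := ContinuousAddMonoidHom.id M.B
     surjective := Function.surjective_id
     a₁ := 1
     a₂ := 1
     map_c₁ := fun s => by simp
     map_c₂ := fun s => by simp
     map_β := by simp [mul_comm] }⟩

/-- **Def 5.6 (i)** — a NON-identity endomorphism of every object: negation `x ↦ -x` (a surjective continuous
homomorphism of the abelian topological group `B`, carrying each one-parameter subgroup onto itself with
rescalings `a₁ = a₂ = -1`; `|a₂|·β = β·|a₁|`). [cite: MochizukiAbsTopIII2015, Definition 5.6 (i) p.134] -/
theorem exists_hom_neg (M : TBPlus.{u}) : ∃ φ : M.Hom M, φ.a₁ = -1 ∧ ∀ x, φ.toHom x = -x := by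
  refine ⟨{ toHom := ⟨-(AddMonoidHom.id M.B), continuous_neg⟩
            surjective := fun y => ⟨-y, ?_⟩
            a₁ := -1
            a₂ := -1
            map_c₁ := fun s => ?_
            map_c₂ := fun s => ?_
            map_β := by simp [mul_comm] }, rfl, fun _ => rfl⟩
  · show -(-y) = y
    exact neg_neg y
  · show -(M.c₁ s) = M.c₁ (-1 * s)
    rw [neg_one_mul, map_neg]
  · show -(M.c₂ s) = M.c₂ (-1 * s)
    rw [neg_one_mul, map_neg]

/-- **Def 5.6 (i)** — morphisms of `TB⊞` compose (composition of the homomorphisms, product of the rescalings),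
so `Nonempty (Hom · ·)` is transitive. [cite: MochizukiAbsTopIII2015, Definition 5.6 (i) p.134] -/
theorem nonempty_hom_trans {M₁ M₂ M₃ : TBPlus.{u}} (φ : M₁.Hom M₂) (ψ : M₂.Hom M₃) : Nonempty (M₁.Hom M₃) :=
  ⟨{ toHom := ψ.toHom.comp φ.toHom
     surjective := ψ.surjective.comp φ.surjective
     a₁ := ψ.a₁ * φ.a₁
     a₂ := ψ.a₂ * φ.a₂
     map_c₁ := fun s => by
       show ψ.toHom (φ.toHom (M₁.c₁ s)) = _
       rw [φ.map_c₁, ψ.map_c₁, mul_assoc]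
     map_c₂ := fun s => by
       show ψ.toHom (φ.toHom (M₁.c₂ s)) = _
       rw [φ.map_c₂, ψ.map_c₂, mul_assoc]
     map_β := by
       have h₁ := φ.map_β
       have h₂ := ψ.map_β
       rw [abs_mul, abs_mul]
       calc |ψ.a₂| * |φ.a₂| * M₁.β = |ψ.a₂| * (M₂.β * |φ.a₁|) := by rw [mul_assoc, h₁]
         _ = (|ψ.a₂| * M₂.β) * |φ.a₁| := by ring
         _ = (M₃.β * |ψ.a₁|) * |φ.a₁| := by rw [h₂]
         _ = M₃.β * (|ψ.a₁| * |φ.a₁|) := by ring }⟩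

end TBPlus

end Literature.AnabelianGeometry.AbsoluteAnabelian
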